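import Summits.NavierStokesRegularity.NavierStokesRegularity.Theorems.ExtremiserTransienceNearExtremalTransienceExtremiserLiouvilleConstantSpeedMultiplierMeasure
import Summits.NavierStokesRegularity.NavierStokesRegularity.Theorems.ExtremiserTransienceNearExtremalTransienceExtremiserLiouvillePlateau
import HarnessLib

/-!
# Crux `ExtremiserTransience.NearExtremalTransience` (stmt-NavierStokesRegularity-21883), line `extremiser_liouville`,
# stub K1b — IDENTITIES OF THE KKT MULTIPLIER MEASURE (mass from below, the multiplier opposes the far field)

`--supports stmt-NavierStokesRegularity-21883` (helper).  Author: prover seat `ns-el-k1b` (g3).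

Continuation of `…ConstantSpeedMultiplierMeasure` (`exists_multiplierMeasure`: `ℓ(φ) = ∫⟪v, φ⟫ dμ`, `μ ≥ 0`,
`μ(ℝ³) ≤ κ⋆²ZW`).  Let `c` be the far field of the constant-speed extended extremiser `v` (`‖c‖ = M`, `v − c ∈ L⁶`,
`…ConstantSpeedTools.exists_farField_of_constSpeed`) and `V := v − c`.  Testing the multiplier identity with the
solenoidal truncations `Ψ_R` of `V` (`Ψ_R → V` boundedly pointwise, and `J₁(Ψ_R) → 3S`, `a₁(Ψ_R) → Z`, `c₁(Ψ_R) → W`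
by `…PlateauTruncationLimits`) gives, with `S² = κ⋆²M²ZW`:

* `multiplier_integral_inner_sub` : `∫ ⟪v, v − c⟫ dμ = S²`, i.e. (`⟪v, v − c⟫ = ‖v − c‖²/2`)
  `multiplier_integral_normSq_sub` : **`∫ ‖v − c‖² dμ = 2 S²`**;
* `multiplier_mass_ge` : since `‖v − c‖ ≤ 2M`, **`μ(ℝ³) ≥ S²/(2M²) > 0`** — the multiplier is NOT zero, and with the
  upper bound `μ(ℝ³) ≤ κ⋆²ZW = S²/M²` its mass is pinned within a factor `2`;
* `multiplier_integral_inner_farField_nonpos` : **`∫ ⟪v x, c⟫ dμ ≤ 0`** — on μ-average the extremiser points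
  AGAINST its own far field: the multiplier lives (on average) in the reversal hemisphere `{⟪v, c⟫ ≤ 0}` of
  `…ConstantSpeedReversal` (which it re-proves: `μ ≠ 0` and `∫⟪v,c⟫dμ ≤ 0` give a point with `⟪v x, c⟫ ≤ 0`);
* `exists_multiplierMeasure_farField` : the package (existence + all identities) for the dossier.

WHAT THIS IS NOT: necessary conditions on the HYPOTHETICAL K1b residue object; K1b is NOT proved; nothing here
proves NS regularity. [folklore]
-/

noncomputable section

open Set Filter Topology MeasureTheory Metric Function
open scoped ENNReal NNReal Topology InnerProductSpace RealInnerProductSpace ContDiff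
open Literature.Analysis.FluidPDE Literature.Analysis

namespace Summit.NavierStokesRegularity.NavierStokesRegularity.Theorems

-- the problem directory repeats the summit name (`NavierStokesRegularity/NavierStokesRegularity`)
set_option linter.dupNamespace false

namespace ExtremiserLiouville

open DepletionLadder.KStar DepletionLadder.KStar.HalfSpace

variable {v : E3 → E3}

/-! ## Uniform bound for the solenoidal truncations of a bounded field -/

/-- The Poincaré field `∫₀¹ t V(t x) dt` of a field bounded by `K` is bounded by `K`. [folklore] -/
theorem norm_poincareField_le_of_bounded {V : E3 → E3} {K : ℝ} (hK : ∀ x, ‖V x‖ ≤ K) (x : E3) :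
    ‖poincareField V x‖ ≤ K := by
  rw [poincareField_apply]
  have h := intervalIntegral.norm_integral_le_of_norm_le_const (a := (0 : ℝ)) (b := 1) (C := K)
    (f := fun t : ℝ => t • V (t • x)) fun t ht => ?_
  · simpa using h
  · rw [Set.uIoc_of_le zero_le_one] at ht
    rw [norm_smul, Real.norm_of_nonneg ht.1.le]
    calc t * ‖V (t • x)‖ ≤ 1 * K := mul_le_mul ht.2 (hK _) (norm_nonneg _) zero_le_one
      _ = K := one_mul K

/-- The solenoidal truncations `Ψ_R` (`R > 0`) of a bounded field are bounded uniformly in `R`. [folklore] -/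
theorem exists_norm_solenoidalTruncation_le_of_bounded {V : E3 → E3} {K : ℝ} (hK : ∀ x, ‖V x‖ ≤ K) :
    ∃ D : ℝ, ∀ R : ℝ, 0 < R → ∀ x, ‖solenoidalTruncation V R x‖ ≤ D := by
  obtain ⟨C₁, hC₁, hcut⟩ := exists_norm_fderiv_cutoff_le (E := E3)
  have hF : ∀ x, ‖poincareField V x‖ ≤ K := norm_poincareField_le_of_bounded hK
  refine ⟨K + 4 * C₁ * K + K, fun R hR x => ?_⟩
  have h := norm_solenoidalTruncation_sub_le (V := V) hC₁ hcut hR x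
  calc ‖solenoidalTruncation V R x‖ = ‖(solenoidalTruncation V R x - V x) + V x‖ := by rw [sub_add_cancel]
    _ ≤ ‖solenoidalTruncation V R x - V x‖ + ‖V x‖ := norm_add_le _ _
    _ ≤ (‖V x‖ + 4 * C₁ * ‖poincareField V x‖) + ‖V x‖ := by gcongr
    _ ≤ (K + 4 * C₁ * K) + K := by gcongr <;> first | exact hK x | exact hF x

/-! ## The testing identity `∫ ⟪v, v − c⟫ dμ = S²` -/

/-- **Testing the multiplier with `v − c`.**  For a constant-speed extended extremiser `v` with `v − c ∈ L⁶` and any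
finite measure `μ` representing the first variation (`ℓ(φ) = ∫⟪v,φ⟫dμ` on smooth compactly supported
divergence-free `φ`): `∫ ⟪v, v − c⟫ dμ = S²`. [folklore] -/
theorem multiplier_integral_inner_sub (hv : ContDiff ℝ ∞ v) (hdiv : VectorCalculus.IsDivFree v) {M B : ℝ}
    (hM : ∀ x, ‖v x‖ ≤ M) (hB : ∀ x, ‖fderiv ℝ v x‖ ≤ B)
    (h1 : ∫⁻ x, ‖iteratedFDeriv ℝ 1 v x‖ₑ ^ 2 < ⊤) (h2 : ∫⁻ x, ‖iteratedFDeriv ℝ 2 v x‖ₑ ^ 2 < ⊤)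
    (hatt : |Jst v| = kStar * M * Real.sqrt (Zen v) * Real.sqrt (Wpa v))
    {c : E3} (hmem : MemLp (fun x => v x - c) 6 volume)
    {μ : Measure E3} [IsFiniteMeasure μ]
    (hμ : ∀ φ : E3 → E3, ContDiff ℝ ∞ φ → HasCompactSupport φ → VectorCalculus.IsDivFree φ →
      Jst v * J1 v φ - kStar ^ 2 * M ^ 2 * (Wpa v * A1 v φ + Zen v * C1 v φ) = ∫ x, ⟪v x, φ x⟫_ℝ ∂μ) :
    ∫ x, ⟪v x, v x - c⟫_ℝ ∂μ = Jst v ^ 2 := by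
  have hZ0 : 0 ≤ Zen v := integral_nonneg fun x => sq_nonneg _
  have hW0 : 0 ≤ Wpa v := integral_nonneg fun x => frobeniusNormSq_nonneg _
  have hS2 : Jst v ^ 2 = kStar ^ 2 * M ^ 2 * Zen v * Wpa v := by
    rw [← sq_abs, hatt, mul_pow, mul_pow, mul_pow, Real.sq_sqrt hZ0, Real.sq_sqrt hW0]
  -- `V := v − c` and its bookkeeping (as in `…Plateau`)
  set V : E3 → E3 := fun x => v x - c with hVdef
  have hv1 : ContDiff ℝ 1 v := contDiff_infty.1 hv 1
  have hV : ContDiff ℝ (⊤ : ℕ∞) V := hv.sub contDiff_const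
  have hV1 : ContDiff ℝ 1 V := contDiff_infty.1 hV 1
  have hVdiv : VectorCalculus.IsDivFree V := isDivFree_sub_const hdiv c
  have hDV : fderiv ℝ V = fderiv ℝ v := funext fun y => fderiv_sub_const c
  have hcurlV : curl V = curl v := curl_sub_const_eq v c
  have hiter : ∀ n : ℕ, iteratedFDeriv ℝ (n + 1) V = iteratedFDeriv ℝ (n + 1) v := by
    intro n
    ext1 y
    rw [iteratedFDeriv_succ_eq_comp_right, iteratedFDeriv_succ_eq_comp_right]
    simp only [Function.comp, hVdef, fderiv_sub_const]
  have hD1V : ∫⁻ x, ‖iteratedFDeriv ℝ 1 V x‖ₑ ^ 2 < ⊤ := by rw [hiter 0]; exact h1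
  have hD2V : ∫⁻ x, ‖iteratedFDeriv ℝ 2 V x‖ₑ ^ 2 < ⊤ := by rw [hiter 1]; exact h2
  have hV6 : ∫⁻ x, ‖V x‖ₑ ^ 6 < ⊤ := by
    have h := lintegral_rpow_enorm_lt_top_of_eLpNorm_lt_top (by norm_num) (by norm_num) hmem.eLpNorm_lt_top
    simp only [ENNReal.toReal_ofNat] at h
    refine lt_of_le_of_lt (le_of_eq (lintegral_congr fun x => ?_)) h
    rw [show (6 : ℝ) = ((6 : ℕ) : ℝ) by norm_num, ENNReal.rpow_natCast]
  have hBV : ∀ y, ‖fderiv ℝ V y‖ ≤ B := fun y => by rw [hDV]; exact hB y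
  -- the three first-variation integrals converge along `Ψ_R := solenoidalTruncation V R`
  have hJ := tendsto_truncation_stretchingVariation hV hBV hV6 hD1V
  have hA := tendsto_truncation_enstrophyVariation hV hV6 hD1V
  have hC := tendsto_truncation_palinstrophyVariation hV hV6 hD1V hD2V
  rw [hcurlV, hDV] at hJ
  rw [hcurlV] at hA hC
  have hJ' : Tendsto (fun R : ℝ => J1 v (solenoidalTruncation V R)) atTop (𝓝 (3 * Jst v)) := hJ
  have hA' : Tendsto (fun R : ℝ => A1 v (solenoidalTruncation V R)) atTop (𝓝 (Zen v)) := hA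
  have hC' : Tendsto (fun R : ℝ => C1 v (solenoidalTruncation V R)) atTop (𝓝 (Wpa v)) := hC
  have hlim : Tendsto (fun R : ℝ => Jst v * J1 v (solenoidalTruncation V R) -
      kStar ^ 2 * M ^ 2 * (Wpa v * A1 v (solenoidalTruncation V R) + Zen v * C1 v (solenoidalTruncation V R)))
      atTop (𝓝 (Jst v * (3 * Jst v) - kStar ^ 2 * M ^ 2 * (Wpa v * Zen v + Zen v * Wpa v))) :=
    (hJ'.const_mul (Jst v)).sub (((hA'.const_mul (Wpa v)).add (hC'.const_mul (Zen v))).const_mul _)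
  have hval : Jst v * (3 * Jst v) - kStar ^ 2 * M ^ 2 * (Wpa v * Zen v + Zen v * Wpa v) = Jst v ^ 2 := by
    linear_combination (2 : ℝ) * hS2
  rw [hval] at hlim
  -- the right-hand sides converge by dominated convergence (`Ψ_R → V` boundedly, `μ` finite)
  have hM0 : 0 ≤ M := (norm_nonneg _).trans (hM 0)
  have hVK : ∀ x, ‖V x‖ ≤ M + ‖c‖ := fun x => (norm_sub_le _ _).trans (by linarith [hM x])
  obtain ⟨D, hD⟩ := exists_norm_solenoidalTruncation_le_of_bounded hVK
  have hRHS : Tendsto (fun R : ℝ => ∫ x, ⟪v x, solenoidalTruncation V R x⟫_ℝ ∂μ) atTop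
      (𝓝 (∫ x, ⟪v x, V x⟫_ℝ ∂μ)) := by
    refine tendsto_integral_filter_of_dominated_convergence (fun _ => M * D) ?_ ?_ (integrable_const _) ?_
    · exact Eventually.of_forall fun R =>
        (hv.continuous.inner (contDiff_solenoidalTruncation hV R).continuous).aestronglyMeasurable
    · refine (eventually_gt_atTop 0).mono fun R hR => Eventually.of_forall fun x => ?_
      calc ‖⟪v x, solenoidalTruncation V R x⟫_ℝ‖ ≤ ‖v x‖ * ‖solenoidalTruncation V R x‖ := norm_inner_le_norm _ _
        _ ≤ M * D := mul_le_mul (hM x) (hD R hR x) (norm_nonneg _) hM0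
    · refine Eventually.of_forall fun x => ?_
      refine (tendsto_const_nhds (x := ⟪v x, V x⟫_ℝ)).congr' ?_
      refine (eventually_gt_atTop ‖x‖).mono fun R hR => ?_
      show ⟪v x, V x⟫_ℝ = ⟪v x, solenoidalTruncation V R x⟫_ℝ
      rw [(solenoidalTruncation_eventuallyEq (lt_of_le_of_lt (norm_nonneg x) hR) hR).eq_of_nhds]
  -- the multiplier identity holds for every `Ψ_R`, `R > 0`
  have hEq : ∀ᶠ R : ℝ in atTop, Jst v * J1 v (solenoidalTruncation V R) -
      kStar ^ 2 * M ^ 2 * (Wpa v * A1 v (solenoidalTruncation V R) + Zen v * C1 v (solenoidalTruncation V R)) =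
      ∫ x, ⟪v x, solenoidalTruncation V R x⟫_ℝ ∂μ :=
    (eventually_gt_atTop 0).mono fun R hR => hμ _ (contDiff_solenoidalTruncation hV R)
      (hasCompactSupport_solenoidalTruncation hR) (isDivFree_solenoidalTruncation finrank_euclideanSpace_fin hV1 hVdiv R)
  exact (tendsto_nhds_unique (hlim.congr' hEq) hRHS).symm

/-- **`∫ ‖v − c‖² dμ = 2S²`** for the far field `c` (`‖c‖ = M = ‖v‖`): since `⟪v, v − c⟫ = ‖v − c‖²/2`. [folklore] -/
theorem multiplier_integral_normSq_sub (hv : ContDiff ℝ ∞ v) (hdiv : VectorCalculus.IsDivFree v) {M B : ℝ}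
    (hM : ∀ x, ‖v x‖ = M) (hB : ∀ x, ‖fderiv ℝ v x‖ ≤ B)
    (h1 : ∫⁻ x, ‖iteratedFDeriv ℝ 1 v x‖ₑ ^ 2 < ⊤) (h2 : ∫⁻ x, ‖iteratedFDeriv ℝ 2 v x‖ₑ ^ 2 < ⊤)
    (hatt : |Jst v| = kStar * M * Real.sqrt (Zen v) * Real.sqrt (Wpa v))
    {c : E3} (hcM : ‖c‖ = M) (hmem : MemLp (fun x => v x - c) 6 volume)
    {μ : Measure E3} [IsFiniteMeasure μ]
    (hμ : ∀ φ : E3 → E3, ContDiff ℝ ∞ φ → HasCompactSupport φ → VectorCalculus.IsDivFree φ →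
      Jst v * J1 v φ - kStar ^ 2 * M ^ 2 * (Wpa v * A1 v φ + Zen v * C1 v φ) = ∫ x, ⟪v x, φ x⟫_ℝ ∂μ) :
    ∫ x, ‖v x - c‖ ^ 2 ∂μ = 2 * Jst v ^ 2 := by
  have h := multiplier_integral_inner_sub hv hdiv (fun x => (hM x).le) hB h1 h2 hatt hmem hμ
  have hpt : ∀ x, ‖v x - c‖ ^ 2 = 2 * ⟪v x, v x - c⟫_ℝ := fun x => by
    rw [norm_sub_sq_real, inner_sub_right, real_inner_self_eq_norm_sq, hM x, hcM]
    ring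
  simp_rw [hpt]
  rw [integral_const_mul, h]

/-- **Lower mass bound: `μ(ℝ³) ≥ S²/(2M²)`** (so `μ ≠ 0` when `S ≠ 0`), from `∫‖v − c‖²dμ = 2S²` and `‖v − c‖ ≤ 2M`.
[folklore] -/
theorem multiplier_mass_ge (hv : ContDiff ℝ ∞ v) (hdiv : VectorCalculus.IsDivFree v) {M B : ℝ}
    (hM : ∀ x, ‖v x‖ = M) (hB : ∀ x, ‖fderiv ℝ v x‖ ≤ B)
    (h1 : ∫⁻ x, ‖iteratedFDeriv ℝ 1 v x‖ₑ ^ 2 < ⊤) (h2 : ∫⁻ x, ‖iteratedFDeriv ℝ 2 v x‖ₑ ^ 2 < ⊤)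
    (hatt : |Jst v| = kStar * M * Real.sqrt (Zen v) * Real.sqrt (Wpa v))
    {c : E3} (hcM : ‖c‖ = M) (hmem : MemLp (fun x => v x - c) 6 volume)
    {μ : Measure E3} [IsFiniteMeasure μ]
    (hμ : ∀ φ : E3 → E3, ContDiff ℝ ∞ φ → HasCompactSupport φ → VectorCalculus.IsDivFree φ →
      Jst v * J1 v φ - kStar ^ 2 * M ^ 2 * (Wpa v * A1 v φ + Zen v * C1 v φ) = ∫ x, ⟪v x, φ x⟫_ℝ ∂μ) :
    Jst v ^ 2 ≤ 2 * M ^ 2 * μ.real univ := by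
  have h := multiplier_integral_normSq_sub hv hdiv hM hB h1 h2 hatt hcM hmem hμ
  have hle : ∀ x, ‖v x - c‖ ^ 2 ≤ (2 * M) ^ 2 := fun x => by
    have hn : ‖v x - c‖ ≤ 2 * M := (norm_sub_le _ _).trans (by rw [hM x, hcM]; linarith)
    exact pow_le_pow_left₀ (norm_nonneg _) hn 2
  have hint : ∫ x, ‖v x - c‖ ^ 2 ∂μ ≤ ∫ x, (2 * M) ^ 2 ∂μ :=
    integral_mono_of_nonneg (Eventually.of_forall fun x => sq_nonneg _) (integrable_const _)
      (Eventually.of_forall hle)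
  rw [integral_const, smul_eq_mul, h] at hint
  nlinarith [hint]

/-- **The multiplier opposes the far field on average: `∫ ⟪v x, c⟫ dμ ≤ 0`** when `μ(ℝ³) ≤ κ⋆²ZW` (the mass bound of
`exists_multiplierMeasure`): `∫⟪v,c⟫dμ = M²μ(ℝ³) − S² ≤ M²·κ⋆²ZW − S² = 0`. [folklore] -/
theorem multiplier_integral_inner_farField_nonpos (hv : ContDiff ℝ ∞ v) (hdiv : VectorCalculus.IsDivFree v) {M B : ℝ}
    (hM : ∀ x, ‖v x‖ = M) (hB : ∀ x, ‖fderiv ℝ v x‖ ≤ B)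
    (h1 : ∫⁻ x, ‖iteratedFDeriv ℝ 1 v x‖ₑ ^ 2 < ⊤) (h2 : ∫⁻ x, ‖iteratedFDeriv ℝ 2 v x‖ₑ ^ 2 < ⊤)
    (hatt : |Jst v| = kStar * M * Real.sqrt (Zen v) * Real.sqrt (Wpa v))
    {c : E3} (hmem : MemLp (fun x => v x - c) 6 volume)
    {μ : Measure E3} [IsFiniteMeasure μ] (hmass : μ univ ≤ ENNReal.ofReal (kStar ^ 2 * Zen v * Wpa v))
    (hμ : ∀ φ : E3 → E3, ContDiff ℝ ∞ φ → HasCompactSupport φ → VectorCalculus.IsDivFree φ →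
      Jst v * J1 v φ - kStar ^ 2 * M ^ 2 * (Wpa v * A1 v φ + Zen v * C1 v φ) = ∫ x, ⟪v x, φ x⟫_ℝ ∂μ) :
    ∫ x, ⟪v x, c⟫_ℝ ∂μ = M ^ 2 * μ.real univ - Jst v ^ 2 ∧ ∫ x, ⟪v x, c⟫_ℝ ∂μ ≤ 0 := by
  have hZ0 : 0 ≤ Zen v := integral_nonneg fun x => sq_nonneg _
  have hW0 : 0 ≤ Wpa v := integral_nonneg fun x => frobeniusNormSq_nonneg _
  have hS2 : Jst v ^ 2 = kStar ^ 2 * M ^ 2 * Zen v * Wpa v := by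
    rw [← sq_abs, hatt, mul_pow, mul_pow, mul_pow, Real.sq_sqrt hZ0, Real.sq_sqrt hW0]
  have h := multiplier_integral_inner_sub hv hdiv (fun x => (hM x).le) hB h1 h2 hatt hmem hμ
  have hint : Integrable (fun x => ⟪v x, v x - c⟫_ℝ) μ := by
    refine Integrable.of_bound (C := M * (M + ‖c‖)) ?_ (Eventually.of_forall fun x => ?_)
    · exact (hv.continuous.inner (hv.continuous.sub continuous_const)).aestronglyMeasurable
    · calc ‖⟪v x, v x - c⟫_ℝ‖ ≤ ‖v x‖ * ‖v x - c‖ := norm_inner_le_norm _ _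
        _ ≤ M * (M + ‖c‖) := mul_le_mul (hM x).le ((norm_sub_le _ _).trans (by rw [hM x]))
            (norm_nonneg _) ((norm_nonneg _).trans (hM x).le)
  have hpt : ∀ x, ⟪v x, c⟫_ℝ = M ^ 2 - ⟪v x, v x - c⟫_ℝ := fun x => by
    rw [inner_sub_right, real_inner_self_eq_norm_sq, hM x]; ring
  have heq : ∫ x, ⟪v x, c⟫_ℝ ∂μ = M ^ 2 * μ.real univ - Jst v ^ 2 := by
    simp_rw [hpt]
    rw [integral_sub (integrable_const _) hint, integral_const, smul_eq_mul, h]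
    ring
  refine ⟨heq, ?_⟩
  rw [heq]
  have hreal : μ.real univ ≤ kStar ^ 2 * Zen v * Wpa v := by
    rw [measureReal_def]
    exact ENNReal.toReal_le_of_le_ofReal (by positivity) hmass
  nlinarith [hreal, hS2, sq_nonneg M]

/-- **The multiplier package with far field** (existence + identities), for the dossier: a constant-speed extended
extremiser `v` (`‖v‖ ≡ M > 0`, `|S| = κ⋆M√Z√W`) carries a far field `c` (`‖c‖ = M`, `v − c → 0`, `v − c ∈ L⁶`) and a
finite positive Borel measure `μ` with `S²/(2M²) ≤ μ(ℝ³) ≤ κ⋆²ZW = S²/M²`, `ℓ(φ) = ∫⟪v,φ⟫dμ` on solenoidal test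
fields, `∫‖v − c‖²dμ = 2S²` and `∫⟪v, c⟫dμ ≤ 0`. [folklore] -/
theorem exists_multiplierMeasure_farField (hv : ContDiff ℝ ∞ v) (hdiv : VectorCalculus.IsDivFree v) {M B : ℝ}
    (hMpos : 0 < M) (hM : ∀ x, ‖v x‖ = M) (hB : ∀ x, ‖fderiv ℝ v x‖ ≤ B)
    (h1 : ∫⁻ x, ‖iteratedFDeriv ℝ 1 v x‖ₑ ^ 2 < ⊤) (h2 : ∫⁻ x, ‖iteratedFDeriv ℝ 2 v x‖ₑ ^ 2 < ⊤)
    (hatt : |Jst v| = kStar * M * Real.sqrt (Zen v) * Real.sqrt (Wpa v)) :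
    ∃ (c : E3) (μ : Measure E3), ‖c‖ = M ∧ Tendsto (fun x => v x - c) (cocompact E3) (𝓝 0) ∧
      MemLp (fun x => v x - c) 6 volume ∧ IsFiniteMeasure μ ∧
      μ univ ≤ ENNReal.ofReal (kStar ^ 2 * Zen v * Wpa v) ∧ Jst v ^ 2 ≤ 2 * M ^ 2 * μ.real univ ∧
      (∀ φ : E3 → E3, ContDiff ℝ ∞ φ → HasCompactSupport φ → VectorCalculus.IsDivFree φ →
        Jst v * J1 v φ - kStar ^ 2 * M ^ 2 * (Wpa v * A1 v φ + Zen v * C1 v φ) = ∫ x, ⟪v x, φ x⟫_ℝ ∂μ) ∧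
      ∫ x, ‖v x - c‖ ^ 2 ∂μ = 2 * Jst v ^ 2 ∧ ∫ x, ⟪v x, c⟫_ℝ ∂μ ≤ 0 := by
  have hv1 : ContDiff ℝ 1 v := contDiff_infty.1 hv 1
  have hD : ∫⁻ x, ‖fderiv ℝ v x‖ₑ ^ 2 < ⊤ := by
    refine lt_of_le_of_lt (le_of_eq (lintegral_congr fun x => ?_)) h1
    rw [(enorm_iteratedFDeriv_one_two v x).1]
  obtain ⟨c, hcM, hdec, hmem, -⟩ := exists_farField_of_constSpeed hv1 hM hB hD
  obtain ⟨μ, hfin, hmass, hμ⟩ := exists_multiplierMeasure hv hdiv hMpos hM hB h1 h2 hatt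
  exact ⟨c, μ, hcM, hdec, hmem, hfin, hmass, multiplier_mass_ge hv hdiv hM hB h1 h2 hatt hcM hmem hμ, hμ,
    multiplier_integral_normSq_sub hv hdiv hM hB h1 h2 hatt hcM hmem hμ,
    (multiplier_integral_inner_farField_nonpos hv hdiv hM hB h1 h2 hatt hmem hmass hμ).2⟩

end ExtremiserLiouville

end Summit.NavierStokesRegularity.NavierStokesRegularity.Theorems

end
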